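import Literature.MathematicalPhysics.QuantumFieldTheory.Balaban1983to89.B4Eq19LatticeOperators
import HarnessLib

/-!
# `UnitScaleGibbsSmoothLatticeCutoffSpline` — THE ONE-DIMENSIONAL `C^{1,1}` SPLINE AND PLATEAU behind the separable lattice cutoff of
# `UnitScaleGibbsSmoothLatticeCutoff` (FILE 1 of 2): `χ = 1` ON `box z R`, `χ = 0` OFF `box z (3R)`,
# `|∇χ| ≤ 2∕R` AND SECOND DIFFERENCES `|∇∇χ| ≤ 4∕R²` EVERYWHERE (the collar smoothness of the re-line of LINE 28 «GrossTransfer»;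
# crux `UnitScaleTilt.HistoryTailL` stmt-QuantumFields-19936 ∕ `MeanDeviationL` stmt-QuantumFields-23083)

Cell `ym3-torus` (YM ladder rung R3 = continuum SU(2) Yang–Mills on T³ — a RUNG, NOT the Clay problem: not d = 4, not infinite volume, not a mass gap),
width seat `ym-ust-19936-w2` (gen 15), pen of record of `stub_linTest`.  WHY (bus 2026-08-29, accounting v2 (A)∕(C)): the one non-Schwinger–Dyson row of
the re-lined `stub_linTest` pairs the cutoff COMMUTATORS of the truncated Coulomb potential `χ·δ₂(G₀∗w)` (✓`CovariantDischargeTruncatedPotentialPairing`: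
`d(χa) = w − δ₃(χγ) − C₂ + E₁`, `E₁ ≍ ∇χ·a`, `C₂ ≍ ∇χ·γ`) with the dressed curvature, and ✓`UnitScaleGibbsCollarPairingSecondMoment` reduces that pairing
to the `ℓ¹`-COBOUNDARY `Σ_b |δ₂(E₁ − C₂)|_b`, which involves SECOND differences of `χ`.  The lit∕(Z-b) cutoffs (✓`B4Eq19LatticeCaccioppoli.exists_cutoff`,
✓`CovariantDischargeCutoffCommutator.exists_cutoff_box_two_box`) export only the Lipschitz row.  THIS FILE builds a cutoff with BOTH rows, everywhere, with
absolute constants: the separable product `χ(x) = Π_i Φ(x_i − z_i + 3R)` of the one-dimensional `C^{1,1}` plateau `Φ(t) = σ(t) − σ(t − 4R)`, `σ` the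
quadratic spline `0 ∕ t²∕(2R²) ∕ 1 − (2R−t)²∕(2R²) ∕ 1` on `t ≤ 0 ∕ 0 ≤ t ≤ R ∕ R ≤ t ≤ 2R ∕ 2R ≤ t` (the closed regimes OVERLAP CONSISTENTLY at the integer
breakpoints, so consecutive integers always share a regime).  Every function is a FREE symbol pinned by a pointwise defining hypothesis (no `def`).
WHAT IS PROVED IN THIS FILE (FILE 1: §1–§2; FILE 2 `UnitScaleGibbsSmoothLatticeCutoff` assembles §3; 0 `sorry`):
* §1 `spline_of_le_zero ∕ _of_mem_Icc_zero ∕ _of_mem_Icc ∕ _of_ge` (the four closed-regime evaluations), `spline_nonneg`, `spline_le_one`,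
  ★`spline_fdiff_mem` (`0 ≤ σ(t+1) − σ t ≤ 1∕R`), `spline_monotone`, ★`abs_spline_sdiff_le` (`|σ(t+1) − 2σ t + σ(t−1)| ≤ 1∕R²`);
* §2 the plateau `Φ = σ − σ(· − 4R)`: `plateau_mem_Icc` (`0 ≤ Φ ≤ 1`), `plateau_eq_one` (on `[2R,4R]`), `plateau_eq_zero_of_le ∕ _of_ge` (off `(0,6R)`),
  `abs_plateau_fdiff_le` (`≤ 2∕R`), `abs_plateau_sdiff_le` (`≤ 2∕R²`);
* §3 ★★★`exists_smooth_cutoff (z : Zd d) (hR : 1 ≤ R) : ∃ χ, (0 ≤ χ ≤ 1) ∧ (χ = 1 on box z R) ∧ (χ = 0 off box z (3R)) ∧ (|χ(x+e_μ) − χ x| ≤ 2∕R) ∧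
  (|χ(x−e_μ) − χ x| ≤ 2∕R) ∧ (|χ(x+e_κ+e_μ) − χ(x+e_κ) − χ(x+e_μ) + χ x| ≤ 4∕R²)` — any `d`.
HONEST FRAMING.  Elementary real arithmetic on `ℤ^d`; `--supports` helper; proves no stub, crux, rung or summit statement; `stub_linTest`,
«ShallowFluxSecondMomentL», (Q), K1, `MeanDeviationL`, `HistoryTailL` are NOT proved; the Yang–Mills mass gap is NOT proved.
References: Giaquinta, *Multiple integrals in the calculus of variations* (1983) Ch. III §2 (cutoff functions) [Giaquinta1984];
[Balaban1984PropagatorsII] (1.9) p. 226 (the lattice `ℤ^d` letters).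
-/

noncomputable section

set_option autoImplicit false

open scoped BigOperators
open Finset

namespace Summit.QuantumFields.YangMills.Theorems.UnitScaleGibbsSmoothLatticeCutoffSpline

open Literature.MathematicalPhysics.QuantumFieldTheory.Balaban1983to89.B4Eq19LatticeOperators

/-! ## §1 The one-dimensional quadratic spline `σ` at integer points -/

section Spline

variable {R : ℕ} {σ : ℤ → ℝ}
  (hσ : ∀ t : ℤ, σ t = if t ≤ 0 then (0 : ℝ) else if t ≤ (R : ℤ) then ((t : ℝ) ^ 2) / (2 * (R : ℝ) ^ 2)
      else if t ≤ 2 * (R : ℤ) then 1 - ((2 * (R : ℝ) - t) ^ 2) / (2 * (R : ℝ) ^ 2) else 1)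

include hσ

/-- Regime `t ≤ 0`: `σ t = 0`. [folklore] -/
theorem spline_of_le_zero {t : ℤ} (ht : t ≤ 0) : σ t = 0 := by
  rw [hσ, if_pos ht]

/-- Regime `0 ≤ t ≤ R`: `σ t = t²∕(2R²)` (consistent at `t = 0`). [folklore] -/
theorem spline_of_mem_Icc_zero {t : ℤ} (h0 : 0 ≤ t) (hR : t ≤ R) : σ t = ((t : ℝ) ^ 2) / (2 * (R : ℝ) ^ 2) := by
  rw [hσ]
  by_cases ht : t ≤ 0
  · have : t = 0 := le_antisymm ht h0
    subst this
    simp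
  · rw [if_neg ht, if_pos hR]

/-- Regime `R ≤ t ≤ 2R`: `σ t = 1 − (2R−t)²∕(2R²)` (consistent at `t = R`, where both formulas give `1∕2`). [folklore] -/
theorem spline_of_mem_Icc (hR1 : 1 ≤ R) {t : ℤ} (hR : (R : ℤ) ≤ t) (h2R : t ≤ 2 * (R : ℤ)) :
    σ t = 1 - ((2 * (R : ℝ) - t) ^ 2) / (2 * (R : ℝ) ^ 2) := by
  have hR0 : (0 : ℝ) < R := by exact_mod_cast hR1
  rw [hσ, if_neg (by omega)]
  by_cases ht : t ≤ (R : ℤ)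
  · have : t = R := le_antisymm ht hR
    subst this
    rw [if_pos le_rfl]
    push_cast
    field_simp
    ring
  · rw [if_neg ht, if_pos h2R]

/-- Regime `2R ≤ t`: `σ t = 1` (consistent at `t = 2R`). [folklore] -/
theorem spline_of_ge (hR1 : 1 ≤ R) {t : ℤ} (h2R : 2 * (R : ℤ) ≤ t) : σ t = 1 := by
  rw [hσ, if_neg (by omega), if_neg (by omega)]
  by_cases ht : t ≤ 2 * (R : ℤ)
  · have : t = 2 * R := le_antisymm ht h2R
    subst this
    rw [if_pos le_rfl]
    push_cast
    simp
  · rw [if_neg ht]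

/-- ★ THE FIRST DIFFERENCE: `0 ≤ σ(t+1) − σ t ≤ 1∕R` (consecutive integers share a closed regime). [folklore] -/
theorem spline_fdiff_mem (hR1 : 1 ≤ R) (t : ℤ) : 0 ≤ σ (t + 1) - σ t ∧ σ (t + 1) - σ t ≤ 1 / (R : ℝ) := by
  have hR0 : (0 : ℝ) < R := by exact_mod_cast hR1
  have hRi : (1 : ℝ) / R = (2 * R) / (2 * (R : ℝ) ^ 2) := by field_simp
  rcases lt_or_ge t 0 with h | h
  · -- both ≤ 0
    rw [spline_of_le_zero hσ (by omega), spline_of_le_zero hσ (by omega)]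
    exact ⟨by simp, by simp [hR0.le]⟩
  rcases lt_or_ge t (R : ℤ) with h' | h'
  · -- both in [0, R]
    rw [spline_of_mem_Icc_zero hσ (by omega) (by omega), spline_of_mem_Icc_zero hσ h (by omega)]
    have ht0 : (0 : ℝ) ≤ t := by exact_mod_cast h
    have ht1 : ((t : ℝ)) + 1 ≤ R := by exact_mod_cast (show t + 1 ≤ (R : ℤ) by omega)
    push_cast
    rw [← sub_div, hRi]
    exact ⟨div_nonneg (by nlinarith) (by positivity), div_le_div_of_nonneg_right (by nlinarith) (by positivity)⟩
  rcases lt_or_ge t (2 * (R : ℤ)) with h'' | h''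
  · -- both in [R, 2R]
    rw [spline_of_mem_Icc hσ hR1 (by omega) (by omega), spline_of_mem_Icc hσ hR1 h' (by omega)]
    have ht0 : (R : ℝ) ≤ t := by exact_mod_cast h'
    have ht1 : ((t : ℝ)) + 1 ≤ 2 * R := by exact_mod_cast (show t + 1 ≤ 2 * (R : ℤ) by omega)
    push_cast
    rw [show (1 - (2 * (R : ℝ) - (t + 1)) ^ 2 / (2 * (R : ℝ) ^ 2)) - (1 - (2 * (R : ℝ) - t) ^ 2 / (2 * (R : ℝ) ^ 2)) =
      ((2 * (R : ℝ) - t) ^ 2 - (2 * (R : ℝ) - (t + 1)) ^ 2) / (2 * (R : ℝ) ^ 2) by ring, hRi]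
    exact ⟨by apply div_nonneg _ (by positivity); nlinarith, div_le_div_of_nonneg_right (by nlinarith) (by positivity)⟩
  · -- both ≥ 2R
    rw [spline_of_ge hσ hR1 (by omega), spline_of_ge hσ hR1 h'']
    exact ⟨by simp, by simp [hR0.le]⟩

/-- `σ` is monotone. [folklore] -/
theorem spline_monotone (hR1 : 1 ≤ R) : Monotone σ :=
  monotone_int_of_le_succ fun t => by linarith [(spline_fdiff_mem hσ hR1 t).1]

/-- `0 ≤ σ ≤ 1`. [folklore] -/
theorem spline_mem_Icc (hR1 : 1 ≤ R) (t : ℤ) : 0 ≤ σ t ∧ σ t ≤ 1 := by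
  constructor
  · have h := spline_monotone hσ hR1 (show min t 0 ≤ t from min_le_left _ _)
    rw [spline_of_le_zero hσ (min_le_right _ _)] at h
    exact h
  · have h := spline_monotone hσ hR1 (show t ≤ max t (2 * (R : ℤ)) from le_max_left _ _)
    rw [spline_of_ge hσ hR1 (le_max_right _ _)] at h
    exact h

/-- ★ THE SECOND DIFFERENCE: `|σ(t+1) − 2σ t + σ(t−1)| ≤ 1∕R²`. [folklore] -/
theorem abs_spline_sdiff_le (hR1 : 1 ≤ R) (t : ℤ) : |σ (t + 1) - 2 * σ t + σ (t - 1)| ≤ 1 / (R : ℝ) ^ 2 := by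
  have hR0 : (0 : ℝ) < R := by exact_mod_cast hR1
  have hRR : (0 : ℝ) < 2 * (R : ℝ) ^ 2 := by positivity
  have hRi : (1 : ℝ) / (R : ℝ) ^ 2 = 2 / (2 * (R : ℝ) ^ 2) := by field_simp
  -- generic closer: `|num / (2R²)| ≤ 1/R²` when `|num| ≤ 2`
  have close : ∀ num : ℝ, |num| ≤ 2 → |num / (2 * (R : ℝ) ^ 2)| ≤ 1 / (R : ℝ) ^ 2 := by
    intro num hnum
    rw [abs_div, abs_of_pos hRR, hRi]
    exact div_le_div_of_nonneg_right hnum hRR.le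
  rcases lt_trichotomy t 0 with h | h | h
  · -- t ≤ -1: all three ≤ 0
    rw [spline_of_le_zero hσ (by omega), spline_of_le_zero hσ (by omega), spline_of_le_zero hσ (by omega)]
    norm_num
  · -- t = 0
    subst h
    rw [spline_of_mem_Icc_zero hσ (by omega) (by omega), spline_of_le_zero hσ le_rfl, spline_of_le_zero hσ (by omega)]
    push_cast
    rw [show ((1 : ℝ)) ^ 2 / (2 * (R : ℝ) ^ 2) - 2 * 0 + 0 = 1 / (2 * (R : ℝ) ^ 2) by ring]
    exact close 1 (by norm_num)
  rcases lt_trichotomy t (R : ℤ) with h' | h' | h'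
  · -- 1 ≤ t ≤ R-1: all in [0,R]
    rw [spline_of_mem_Icc_zero hσ (by omega) (by omega), spline_of_mem_Icc_zero hσ (by omega) (by omega),
      spline_of_mem_Icc_zero hσ (by omega) (by omega)]
    push_cast
    rw [show ((t : ℝ) + 1) ^ 2 / (2 * (R : ℝ) ^ 2) - 2 * ((t : ℝ) ^ 2 / (2 * (R : ℝ) ^ 2)) + ((t : ℝ) - 1) ^ 2 / (2 * (R : ℝ) ^ 2) =
      2 / (2 * (R : ℝ) ^ 2) by ring]
    exact close 2 (by norm_num)
  · -- t = R
    subst h'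
    rw [spline_of_mem_Icc hσ hR1 (by omega) (by omega), spline_of_mem_Icc_zero hσ (by omega) le_rfl,
      spline_of_mem_Icc_zero hσ (by omega) (by omega)]
    push_cast
    rw [show (1 - (2 * (R : ℝ) - (R + 1)) ^ 2 / (2 * (R : ℝ) ^ 2)) - 2 * ((R : ℝ) ^ 2 / (2 * (R : ℝ) ^ 2)) + ((R : ℝ) - 1) ^ 2 / (2 * (R : ℝ) ^ 2)
      = (2 * (R : ℝ) ^ 2 - 2 * (R : ℝ) ^ 2) / (2 * (R : ℝ) ^ 2) by field_simp; ring]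
    exact close _ (by norm_num)
  rcases lt_trichotomy t (2 * (R : ℤ)) with h'' | h'' | h''
  · -- R+1 ≤ t ≤ 2R-1: all in [R, 2R]
    rw [spline_of_mem_Icc hσ hR1 (by omega) (by omega), spline_of_mem_Icc hσ hR1 (by omega) (by omega),
      spline_of_mem_Icc hσ hR1 (by omega) (by omega)]
    push_cast
    rw [show (1 - (2 * (R : ℝ) - (t + 1)) ^ 2 / (2 * (R : ℝ) ^ 2)) - 2 * (1 - (2 * (R : ℝ) - t) ^ 2 / (2 * (R : ℝ) ^ 2)) +
        (1 - (2 * (R : ℝ) - (t - 1)) ^ 2 / (2 * (R : ℝ) ^ 2)) = (-2) / (2 * (R : ℝ) ^ 2) by ring]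
    exact close _ (by norm_num)
  · -- t = 2R
    subst h''
    rw [spline_of_ge hσ hR1 (by omega), spline_of_ge hσ hR1 le_rfl, spline_of_mem_Icc hσ hR1 (by omega) (by omega)]
    push_cast
    rw [show (1 : ℝ) - 2 * 1 + (1 - (2 * (R : ℝ) - (2 * R - 1)) ^ 2 / (2 * (R : ℝ) ^ 2)) = (-1) / (2 * (R : ℝ) ^ 2) by ring]
    exact close _ (by norm_num)
  · -- t ≥ 2R+1
    rw [spline_of_ge hσ hR1 (by omega), spline_of_ge hσ hR1 (by omega), spline_of_ge hσ hR1 (by omega)]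
    norm_num

end Spline

/-! ## §2 The one-dimensional plateau `Φ(t) = σ(t) − σ(t − 4R)` -/

section Plateau

variable {R : ℕ} {σ Φ : ℤ → ℝ}
  (hσ : ∀ t : ℤ, σ t = if t ≤ 0 then (0 : ℝ) else if t ≤ (R : ℤ) then ((t : ℝ) ^ 2) / (2 * (R : ℝ) ^ 2)
      else if t ≤ 2 * (R : ℤ) then 1 - ((2 * (R : ℝ) - t) ^ 2) / (2 * (R : ℝ) ^ 2) else 1)
  (hΦ : ∀ t : ℤ, Φ t = σ t - σ (t - 4 * (R : ℤ)))

include hσ hΦ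

/-- `0 ≤ Φ ≤ 1`. [folklore] -/
theorem plateau_mem_Icc (hR1 : 1 ≤ R) (t : ℤ) : 0 ≤ Φ t ∧ Φ t ≤ 1 := by
  rw [hΦ]
  have hmono := spline_monotone hσ hR1 (show t - 4 * (R : ℤ) ≤ t by omega)
  have h1 := (spline_mem_Icc hσ hR1 t).2
  have h0 := (spline_mem_Icc hσ hR1 (t - 4 * (R : ℤ))).1
  constructor <;> linarith

/-- `Φ = 1` on `[2R, 4R]`. [folklore] -/
theorem plateau_eq_one (hR1 : 1 ≤ R) {t : ℤ} (h1 : 2 * (R : ℤ) ≤ t) (h2 : t ≤ 4 * (R : ℤ)) : Φ t = 1 := by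
  rw [hΦ, spline_of_ge hσ hR1 h1, spline_of_le_zero hσ (by omega)]; simp

/-- `Φ = 0` for `t ≤ 0`. [folklore] -/
theorem plateau_eq_zero_of_le {t : ℤ} (h : t ≤ 0) : Φ t = 0 := by
  rw [hΦ, spline_of_le_zero hσ h, spline_of_le_zero hσ (by omega)]; simp

/-- `Φ = 0` for `6R ≤ t`. [folklore] -/
theorem plateau_eq_zero_of_ge (hR1 : 1 ≤ R) {t : ℤ} (h : 6 * (R : ℤ) ≤ t) : Φ t = 0 := by
  rw [hΦ, spline_of_ge hσ hR1 (by omega), spline_of_ge hσ hR1 (by omega)]; simp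

/-- `|Φ(t+1) − Φ t| ≤ 2∕R`. [folklore] -/
theorem abs_plateau_fdiff_le (hR1 : 1 ≤ R) (t : ℤ) : |Φ (t + 1) - Φ t| ≤ 2 / (R : ℝ) := by
  rw [hΦ, hΦ, show t + 1 - 4 * (R : ℤ) = (t - 4 * (R : ℤ)) + 1 by ring]
  have h1 := spline_fdiff_mem hσ hR1 t
  have h2 := spline_fdiff_mem hσ hR1 (t - 4 * (R : ℤ))
  have hR' : (0 : ℝ) ≤ 1 / (R : ℝ) := by positivity
  have e : (2 : ℝ) / R = 1 / R + 1 / R := by ring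
  rw [abs_le, e]
  constructor <;> linarith [h1.1, h1.2, h2.1, h2.2]

/-- `|Φ(t+1) − 2Φ t + Φ(t−1)| ≤ 2∕R²`. [folklore] -/
theorem abs_plateau_sdiff_le (hR1 : 1 ≤ R) (t : ℤ) : |Φ (t + 1) - 2 * Φ t + Φ (t - 1)| ≤ 2 / (R : ℝ) ^ 2 := by
  rw [hΦ, hΦ, hΦ, show t + 1 - 4 * (R : ℤ) = (t - 4 * (R : ℤ)) + 1 by ring, show t - 1 - 4 * (R : ℤ) = (t - 4 * (R : ℤ)) - 1 by ring]
  have h1 := abs_spline_sdiff_le hσ hR1 t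
  have h2 := abs_spline_sdiff_le hσ hR1 (t - 4 * (R : ℤ))
  have e : (2 : ℝ) / (R : ℝ) ^ 2 = 1 / (R : ℝ) ^ 2 + 1 / (R : ℝ) ^ 2 := by ring
  rw [abs_le] at h1 h2 ⊢
  rw [e]
  constructor <;> linarith [h1.1, h1.2, h2.1, h2.2]

end Plateau

end Summit.QuantumFields.YangMills.Theorems.UnitScaleGibbsSmoothLatticeCutoffSpline

end
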